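import Mathlib.Algebra.Order.Chebyshev
import Mathlib.Algebra.BigOperators.Field
import Mathlib.Analysis.SpecialFunctions.Pow.Real
import Mathlib.Analysis.SpecialFunctions.Sqrt
import HarnessLib
/-!
# Projection games (two-prover one-round games with projection constraints): value and collision value

Topic `Computability/Complexity`, namespace `Literature.Computability.Complexity.ProjGame`. The
linear-algebraic set-up of Dinur–Steurer, *Analytical approach to parallel repetition* (STOC 2014;
arXiv:1305.1979), §2, for WEIGHTED projection games, everything PROVED:

* `ProjGame E V U β α` — a projection game: finitely many edges `e : E`, each joining a vertex
  `src e : V` of Bob (the PROJECTED side; `fst` in the tree's `LabelCoverConstraint`) to a vertex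
  `dst e : U` of Alice (`snd`), carrying a positive weight `wt e` and a projection constraint
  `proj e : β → Option α` ("each `β` has at most one `α` for which `(α, β) ∈ π`", §2.1); no
  isolated vertices (`src`, `dst` surjective).
* `satW b a` — the weight of the constraints satisfied by deterministic strategies `b : V → β`,
  `a : U → α`; `ValLe θ` — "`val(G) ≤ θ`": every pair of strategies satisfies weight `≤ θ · total`.
* fractional assignments `f : V → β → ℝ` for Bob ("`f(v, β)` = the probability that Bob answers `β`",
  §2.1), the operator `app f u a = (G f)(u, α) = 𝔼_{(v,π)|u} ∑_{β ↦ α} f(v, β)` (§2.1, "linear-algebra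
  notation"), the squared collision value `normG f = ‖G f‖² = 𝔼_u ∑_α (G f)(u, α)²` (§2.3) and the
  squared norm `normT f = ‖T f‖² = 𝔼_v (∑_β f(v, β))²` of the trivial game `T` (§2.5); linearity of `app`.
* **Claim 2.3** (`val(G) ≤ ‖G‖ ≤ val(G)^{1/2}`) in the two forms used downstream:
  `sq_satW_div_le_normG` — `(satW b a / total)² ≤ ‖G 1_b‖²` (Cauchy–Schwarz), and
  `normG_le_of_valLe` — `‖G f‖² ≤ θ` for every fractional assignment `f` when `val(G) ≤ θ`
  ("`G f` can be turned into a proper assignment `g` …; randomized strategies are no better than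
  deterministic ones", vertex-wise maximisation).

This is the first brick of the tree's proof of parallel repetition for expanding projection games
(Dinur–Steurer §3, `ParallelRepetitionExpanding.lean`), which serves the NP-hardness of gap label
cover for every constant soundness error (`LabelCover.lean`, `GapSetCoverProofs.lean`:
`AroraEtAl1997_prop6_of_isNPHard_gapLabelCover`).

## Design / faithfulness

* Dinur–Steurer allow "parallel edges and edges with nonnegative weights" and let the graph define
  probability measures on `U` and `V` (§2.1); here edges form an arbitrary finite type with
  positive weights, `μ_U(u) = wU u / total`, `μ_V(v) = wV v / total`, and conditional expectations
  `𝔼_{(v,π)|u}` are the weighted averages over the edges at `u` (`wU u > 0` by surjectivity of `dst`).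
  Inner products are `⟨g, g'⟩ = 𝔼_u ∑_α g(u,α) g'(u,α)` (measure on vertices × counting measure on
  labels), exactly as printed.
* Only real numbers and finite sums are used (no measure theory): every `𝔼` is a finite weighted sum.
* Mathlib has no two-prover games / label cover (searched `projection game`, `two-prover`,
  `parallel repetition`); the tree's `LabelCoverInstance` (`LabelCover.lean`) is the list-based
  Boolean-encodable form, connected to `ProjGame` in `LabelCoverAmplification.lean`.

## References

* I. Dinur, D. Steurer, *Analytical approach to parallel repetition*, Proc. 46th STOC (2014)
  624–633; full version arXiv:1305.1979: §2.1 (games and linear operators, Claim 2.1), §2.3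
  (collision value, Claim 2.3), §2.5 (the trivial games `T`, `T_v`).
* R. Raz, *A parallel repetition theorem*, SIAM J. Comput. 27 (1998) 763–803 (the theorem these
  files re-prove in the expanding/projection case).
-/

namespace Literature.Computability.Complexity

open Finset

/-- A (weighted) **projection game** (Dinur–Steurer 2014, §2.1): edges `e : E` between Bob's vertex
`src e : V` and Alice's vertex `dst e : U`, with positive weight `wt e` and the projection constraint
`proj e : β → Option α` — Bob's answer `β` is accepted together with Alice's answer `α` iff
`proj e β = some α` ("each `β` has at most one `α`"). Both vertex maps are surjective (no isolated
vertices, so that all conditional distributions exist). No finiteness or decidability instance is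
part of the type; they are assumed where sums are taken. [cite: DinurSteurer2014, §2.1] -/
structure ProjGame (E V U β α : Type) where
  /-- Bob's endpoint of an edge (the projected side). -/
  src : E → V
  /-- Alice's endpoint of an edge. -/
  dst : E → U
  /-- The projection constraint of an edge: `proj e β = some α` iff `(α, β) ∈ π_e`. -/
  proj : E → β → Option α
  /-- The weight of an edge. -/
  wt : E → ℝ
  /-- Weights are positive. -/
  wt_pos : ∀ e, 0 < wt e
  /-- Every vertex of Bob lies on an edge. -/
  src_surj : Function.Surjective src
  /-- Every vertex of Alice lies on an edge. -/
  dst_surj : Function.Surjective dst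

namespace ProjGame

/-! ### Fractional assignments (no game needed) -/

section Assignments

variable {V β : Type}

/-- Nonnegative functions `V × β → ℝ` ("fractional assignments" in the wide sense of §4). [cite: DinurSteurer2014, §4 (Terminology)] -/
def Nonneg (f : V → β → ℝ) : Prop := ∀ v b, 0 ≤ f v b

variable [DecidableEq β]

/-- The indicator fractional assignment of a deterministic strategy `b`. [cite: DinurSteurer2014, §2.1] -/
def indic (b : V → β) : V → β → ℝ := fun v b' => if b' = b v then 1 else 0

/-- The indicator assignment is nonnegative. [folklore] -/
theorem indic_nonneg (b : V → β) : Nonneg (indic b) := fun v b' => by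
  unfold indic; split_ifs; exacts [zero_le_one, le_rfl]

/-- The indicator assignment has row sums `1`. [folklore] -/
theorem sum_indic [Fintype β] (b : V → β) (v : V) : ∑ b', indic b v b' = 1 := by
  unfold indic
  rw [sum_ite_eq' univ (b v) (fun _ => (1 : ℝ)), if_pos (mem_univ _)]

end Assignments

variable {E V U β α : Type} [Fintype E] [Fintype V] [Fintype U] [Fintype β] [Fintype α]
  [DecidableEq V] [DecidableEq U] [DecidableEq β] [DecidableEq α]
  (G : ProjGame E V U β α)

/-! ### Weights and the induced measures -/

/-- The total weight `∑_e w_e` (the normalisation of the edge distribution). [cite: DinurSteurer2014, §2.1] -/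
def total : ℝ := ∑ e, G.wt e

/-- The weight `wV v` of the edges at Bob's vertex `v` (`μ_V(v) = wV v / total`). [cite: DinurSteurer2014, §2.1] -/
def wV (v : V) : ℝ := ∑ e, if G.src e = v then G.wt e else 0

/-- The weight `wU u` of the edges at Alice's vertex `u` (`μ_U(u) = wU u / total`). [cite: DinurSteurer2014, §2.1] -/
def wU (u : U) : ℝ := ∑ e, if G.dst e = u then G.wt e else 0

omit [Fintype E] [Fintype V] [Fintype U] [Fintype β] [Fintype α] [DecidableEq V] [DecidableEq U] [DecidableEq β] [DecidableEq α] in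
/-- Weights are nonnegative. [folklore] -/
theorem wt_nonneg (e : E) : 0 ≤ G.wt e := (G.wt_pos e).le

omit [Fintype U] [Fintype β] [Fintype α] [DecidableEq U] [DecidableEq β] [DecidableEq α] in
/-- `∑_v wV v = total`. [folklore] -/
theorem sum_wV : ∑ v, G.wV v = G.total := by
  unfold wV total
  rw [sum_comm]
  exact sum_congr rfl fun e _ => by rw [sum_ite_eq univ (G.src e) (fun _ => G.wt e), if_pos (mem_univ _)]

omit [Fintype V] [Fintype β] [Fintype α] [DecidableEq V] [DecidableEq β] [DecidableEq α] in
/-- `∑_u wU u = total`. [folklore] -/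
theorem sum_wU : ∑ u, G.wU u = G.total := by
  unfold wU total
  rw [sum_comm]
  exact sum_congr rfl fun e _ => by rw [sum_ite_eq univ (G.dst e) (fun _ => G.wt e), if_pos (mem_univ _)]

omit [Fintype V] [Fintype U] [Fintype β] [Fintype α] [DecidableEq V] [DecidableEq β] [DecidableEq α] in
/-- Every vertex of Alice has positive weight. [folklore] -/
theorem wU_pos (u : U) : 0 < G.wU u := by
  obtain ⟨e, he⟩ := G.dst_surj u
  unfold wU
  refine lt_of_lt_of_le (G.wt_pos e) ?_
  refine le_trans (le_of_eq (by rw [if_pos he])) (single_le_sum (f := fun e' => if G.dst e' = u then G.wt e' else 0)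
    (fun e' _ => ?_) (mem_univ e))
  split_ifs
  · exact G.wt_nonneg e'
  · exact le_rfl

omit [Fintype V] [Fintype U] [Fintype β] [Fintype α] [DecidableEq U] [DecidableEq β] [DecidableEq α] in
/-- Every vertex of Bob has positive weight. [folklore] -/
theorem wV_pos (v : V) : 0 < G.wV v := by
  obtain ⟨e, he⟩ := G.src_surj v
  unfold wV
  refine lt_of_lt_of_le (G.wt_pos e) ?_
  refine le_trans (le_of_eq (by rw [if_pos he])) (single_le_sum (f := fun e' => if G.src e' = v then G.wt e' else 0)
    (fun e' _ => ?_) (mem_univ e))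
  split_ifs
  · exact G.wt_nonneg e'
  · exact le_rfl

omit [Fintype V] [Fintype U] [Fintype β] [Fintype α] [DecidableEq V] [DecidableEq U] [DecidableEq β] [DecidableEq α] in
/-- The total weight is nonnegative. [folklore] -/
theorem total_nonneg : 0 ≤ G.total := sum_nonneg fun e _ => G.wt_nonneg e

omit [Fintype V] [Fintype U] [Fintype β] [Fintype α] [DecidableEq V] [DecidableEq U] [DecidableEq β] [DecidableEq α] in
/-- The total weight is positive as soon as there is an edge. [folklore] -/
theorem total_pos [Nonempty E] : 0 < G.total := by
  obtain ⟨e⟩ := ‹Nonempty E›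
  exact lt_of_lt_of_le (G.wt_pos e) (single_le_sum (f := G.wt) (fun e' _ => G.wt_nonneg e') (mem_univ e))

omit [Fintype V] [Fintype β] [Fintype α] [DecidableEq V] [DecidableEq β] [DecidableEq α] in
/-- `∑_u μ_U(u) = 1`. [folklore] -/
theorem sum_wU_div_total [Nonempty E] : ∑ u, G.wU u / G.total = 1 := by
  rw [← sum_div, sum_wU, div_self G.total_pos.ne']

omit [Fintype U] [Fintype β] [Fintype α] [DecidableEq U] [DecidableEq β] [DecidableEq α] in
/-- `∑_v μ_V(v) = 1`. [folklore] -/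
theorem sum_wV_div_total [Nonempty E] : ∑ v, G.wV v / G.total = 1 := by
  rw [← sum_div, sum_wV, div_self G.total_pos.ne']

/-! ### Deterministic strategies and the value -/

/-- The weight of the constraints satisfied by the deterministic strategies `b` (Bob) and `a`
(Alice): edge `e` is satisfied iff `proj e (b (src e)) = some (a (dst e))`. The value of the game
is `max_{b,a} satW b a / total`. [cite: DinurSteurer2014, §1 and Claim 2.1] -/
def satW (b : V → β) (a : U → α) : ℝ :=
  ∑ e, if G.proj e (b (G.src e)) = some (a (G.dst e)) then G.wt e else 0

/-- `val(G) ≤ θ`: every pair of deterministic strategies satisfies constraints of total weight at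
most `θ · total`. [cite: DinurSteurer2014, §1 (value of a game)] -/
def ValLe (θ : ℝ) : Prop := ∀ (b : V → β) (a : U → α), G.satW b a ≤ θ * G.total

omit [Fintype V] [Fintype U] [Fintype β] [Fintype α] [DecidableEq V] [DecidableEq U] [DecidableEq β] in
/-- `0 ≤ satW b a`. [folklore] -/
theorem satW_nonneg (b : V → β) (a : U → α) : 0 ≤ G.satW b a :=
  sum_nonneg fun e _ => by split_ifs; exacts [G.wt_nonneg e, le_rfl]

omit [Fintype V] [Fintype U] [Fintype β] [Fintype α] [DecidableEq V] [DecidableEq U] [DecidableEq β] in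
/-- `satW b a ≤ total`. [folklore] -/
theorem satW_le_total (b : V → β) (a : U → α) : G.satW b a ≤ G.total :=
  sum_le_sum fun e _ => by split_ifs; exacts [le_rfl, G.wt_nonneg e]

omit [Fintype V] [Fintype U] [Fintype β] [Fintype α] [DecidableEq V] [DecidableEq U] [DecidableEq β] in
/-- `val(G) ≤ 1`. [folklore] -/
theorem valLe_one : G.ValLe 1 := fun b a => by rw [one_mul]; exact G.satW_le_total b a

omit [Fintype V] [Fintype U] [Fintype β] [Fintype α] [DecidableEq V] [DecidableEq U] [DecidableEq β] in
/-- Monotonicity of the value bound. [folklore] -/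
theorem ValLe.mono {G : ProjGame E V U β α} {θ θ' : ℝ} (h : G.ValLe θ) (hθ : θ ≤ θ') : G.ValLe θ' :=
  fun b a => (h b a).trans (mul_le_mul_of_nonneg_right hθ G.total_nonneg)

/-! ### Fractional assignments, the operator `G`, the collision value -/

/-- `lift f e α = ∑_{β : π_e β = α} f(src e, β)`: the mass that Bob's fractional assignment `f` at the
endpoint of `e` sends to Alice's answer `α` through the projection of `e`. [cite: DinurSteurer2014, §2.1] -/
def lift (f : V → β → ℝ) (e : E) (a : α) : ℝ :=
  ∑ b, if G.proj e b = some a then f (G.src e) b else 0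

/-- The operator of the game (Dinur–Steurer's `G f (u, α) = 𝔼_{(v,π)|u} ∑_{β : α ↤ β} f(v, β)`): the
weighted average of `lift f e α` over the edges `e` at `u`. [cite: DinurSteurer2014, §2.1] -/
noncomputable def app (f : V → β → ℝ) (u : U) (a : α) : ℝ :=
  (∑ e, if G.dst e = u then G.wt e * G.lift f e a else 0) / G.wU u

/-- The squared **collision value** of a fractional assignment, `‖G f‖² = 𝔼_u ∑_α (G f)(u, α)²`.
[cite: DinurSteurer2014, §2.3] -/
noncomputable def normG (f : V → β → ℝ) : ℝ :=
  ∑ u, G.wU u / G.total * ∑ a, G.app f u a ^ 2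

/-- The squared norm `‖T f‖² = 𝔼_v (∑_β f(v, β))²` for the trivial game `T` of §2.5 (the
normalisation in `λ₊(G) = max_{h ≥ 0} ‖G h‖ / ‖T h‖`, Def. 3.1). [cite: DinurSteurer2014, §2.5] -/
noncomputable def normT (f : V → β → ℝ) : ℝ :=
  ∑ v, G.wV v / G.total * (∑ b, f v b) ^ 2

omit [Fintype E] [Fintype V] [Fintype U] [Fintype α] [DecidableEq V] [DecidableEq U] in
/-- `lift` of the indicator of `b` through `e` at `α` is `1` iff `π_e (b (src e)) = α`. [folklore] -/
theorem lift_indic (b : V → β) (e : E) (a : α) :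
    G.lift (indic b) e a = if G.proj e (b (G.src e)) = some a then 1 else 0 := by
  unfold lift indic
  rw [← sum_filter]
  rw [sum_ite_eq' (univ.filter fun b' => G.proj e b' = some a) (b (G.src e)) (fun _ => (1 : ℝ))]
  simp only [mem_filter, mem_univ, true_and]

omit [Fintype E] [Fintype V] [Fintype U] [Fintype α] [DecidableEq V] [DecidableEq U] [DecidableEq β] in
/-- `lift` of a nonnegative function is nonnegative. [folklore] -/
theorem lift_nonneg {f : V → β → ℝ} (hf : Nonneg f) (e : E) (a : α) : 0 ≤ G.lift f e a :=
  sum_nonneg fun b _ => by split_ifs; exacts [hf _ _, le_rfl]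

omit [Fintype V] [Fintype U] [Fintype α] [DecidableEq V] [DecidableEq β] in
/-- `app` of a nonnegative function is nonnegative. [folklore] -/
theorem app_nonneg {f : V → β → ℝ} (hf : Nonneg f) (u : U) (a : α) : 0 ≤ G.app f u a :=
  div_nonneg (sum_nonneg fun e _ => by
    split_ifs; exacts [mul_nonneg (G.wt_nonneg e) (G.lift_nonneg hf e a), le_rfl]) (G.wU_pos u).le

omit [Fintype V] [DecidableEq V] [DecidableEq β] in
/-- `normG f ≥ 0`. [folklore] -/
theorem normG_nonneg (f : V → β → ℝ) : 0 ≤ G.normG f :=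
  sum_nonneg fun u _ => mul_nonneg (div_nonneg (G.wU_pos u).le G.total_nonneg)
    (sum_nonneg fun _ _ => sq_nonneg _)

omit [Fintype U] [Fintype α] [DecidableEq U] [DecidableEq β] [DecidableEq α] in
/-- `normT f ≥ 0`. [folklore] -/
theorem normT_nonneg (f : V → β → ℝ) : 0 ≤ G.normT f :=
  sum_nonneg fun v _ => mul_nonneg (div_nonneg (G.wV_pos v).le G.total_nonneg) (sq_nonneg _)

omit [Fintype E] [Fintype V] [Fintype U] [DecidableEq V] [DecidableEq U] [DecidableEq β] in
/-- `∑_α lift f e α = ∑_{β : π_e β ≠ none} f(src e, β) ≤ ∑_β f(src e, β)` for nonnegative `f`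
(each `β` is sent to at most one `α`). [cite: DinurSteurer2014, Claim 2.3 (proof)] -/
theorem sum_lift_le {f : V → β → ℝ} (hf : Nonneg f) (e : E) :
    ∑ a, G.lift f e a ≤ ∑ b, f (G.src e) b := by
  unfold lift
  rw [sum_comm]
  refine sum_le_sum fun b _ => ?_
  cases h : G.proj e b with
  | none => simp only [reduceCtorEq, if_false, sum_const_zero]; exact hf _ _
  | some a₀ =>
    simp only [Option.some.injEq]
    rw [show (∑ x, if a₀ = x then f (G.src e) b else 0) = f (G.src e) b from by
      rw [sum_ite_eq univ a₀ (fun _ => f (G.src e) b), if_pos (mem_univ _)]]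

omit [Fintype V] [Fintype U] [DecidableEq V] [DecidableEq β] in
/-- For a fractional assignment (`f ≥ 0`, row sums `≤ 1`), `∑_α (G f)(u, α) ≤ 1` ("if `f` is an
assignment then `∑_α G f(u, α) ≤ 1` for every `u`"). [cite: DinurSteurer2014, Claim 2.3 (proof)] -/
theorem sum_app_le_one {f : V → β → ℝ} (hf : Nonneg f) (hf1 : ∀ v, ∑ b, f v b ≤ 1) (u : U) :
    ∑ a, G.app f u a ≤ 1 := by
  unfold app
  rw [← sum_div, div_le_one (G.wU_pos u), sum_comm]
  unfold wU
  refine sum_le_sum fun e _ => ?_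
  by_cases he : G.dst e = u
  · simp only [he, if_true]
    rw [← mul_sum]
    refine le_trans (mul_le_mul_of_nonneg_left ((G.sum_lift_le hf e).trans (hf1 _)) (G.wt_nonneg e)) ?_
    rw [mul_one]
  · simp only [he, if_false, sum_const_zero, le_refl]

omit [Fintype V] [Fintype α] [DecidableEq V] [DecidableEq β] in
/-- `𝔼_u (G f)(u, a u) = (∑_e w_e · lift f e (a (dst e))) / total`: pairing `G f` with the
deterministic strategy `a` of Alice (Claim 2.1, `⟨g, G f⟩`). [cite: DinurSteurer2014, Claim 2.1] -/
theorem sum_mu_app (f : V → β → ℝ) (a : U → α) :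
    ∑ u, G.wU u / G.total * G.app f u (a u) = (∑ e, G.wt e * G.lift f e (a (G.dst e))) / G.total := by
  unfold app
  have h : ∀ u, G.wU u / G.total * ((∑ e, if G.dst e = u then G.wt e * G.lift f e (a u) else 0) / G.wU u) =
      (∑ e, if G.dst e = u then G.wt e * G.lift f e (a u) else 0) / G.total := fun u => by
    rw [div_mul_div_comm, mul_comm (G.wU u), ← div_mul_div_comm, div_self (G.wU_pos u).ne', mul_one]
  simp_rw [h]
  rw [← sum_div, sum_comm]
  congr 1
  refine sum_congr rfl fun e _ => ?_
  rw [sum_ite_eq univ (G.dst e) (fun u => G.wt e * G.lift f e (a u)), if_pos (mem_univ _)]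

/-- A weighted Cauchy–Schwarz inequality: `(∑ μ_u x_u)² ≤ (∑ μ_u) · ∑ μ_u x_u²` for `μ ≥ 0`. [folklore] -/
theorem sq_sum_mul_le_mul_sum_mul_sq {ι : Type} (s : Finset ι) {μ : ι → ℝ} (hμ : ∀ i ∈ s, 0 ≤ μ i)
    (x : ι → ℝ) : (∑ i ∈ s, μ i * x i) ^ 2 ≤ (∑ i ∈ s, μ i) * ∑ i ∈ s, μ i * x i ^ 2 := by
  have h := sum_mul_sq_le_sq_mul_sq s (fun i => Real.sqrt (μ i)) (fun i => Real.sqrt (μ i) * x i)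
  have h1 : ∀ i ∈ s, Real.sqrt (μ i) * (Real.sqrt (μ i) * x i) = μ i * x i := fun i hi => by
    rw [← mul_assoc, Real.mul_self_sqrt (hμ i hi)]
  have h2 : ∀ i ∈ s, Real.sqrt (μ i) ^ 2 = μ i := fun i hi => Real.sq_sqrt (hμ i hi)
  have h3 : ∀ i ∈ s, (Real.sqrt (μ i) * x i) ^ 2 = μ i * x i ^ 2 := fun i hi => by
    rw [mul_pow, Real.sq_sqrt (hμ i hi)]
  rwa [sum_congr rfl h1, sum_congr rfl h2, sum_congr rfl h3] at h

omit [Fintype V] [DecidableEq V] in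
/-- **Dinur–Steurer, Claim 2.3, first inequality (`val(G) ≤ ‖G‖`), deterministic form**: for
strategies `b`, `a`, `(satW b a / total)² ≤ ‖G 1_b‖²` — "`val(G) = ⟨g, G f⟩ ≤ ‖g‖ · ‖G f‖ ≤ ‖G f‖`"
(Cauchy–Schwarz). [cite: DinurSteurer2014, Claim 2.3] -/
theorem sq_satW_div_le_normG [Nonempty E] (b : V → β) (a : U → α) :
    (G.satW b a / G.total) ^ 2 ≤ G.normG (indic b) := by
  -- `satW b a / total = 𝔼_u (G 1_b)(u, a u)`
  have key : G.satW b a / G.total = ∑ u, G.wU u / G.total * G.app (indic b) u (a u) := by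
    rw [sum_mu_app]
    congr 1
    unfold satW
    refine sum_congr rfl fun e _ => ?_
    rw [lift_indic]
    split_ifs <;> simp
  rw [key]
  refine le_trans (sq_sum_mul_le_mul_sum_mul_sq univ (fun u _ => div_nonneg (G.wU_pos u).le G.total_nonneg) _) ?_
  rw [sum_wU_div_total, one_mul]
  unfold normG
  refine sum_le_sum fun u _ => mul_le_mul_of_nonneg_left ?_ (div_nonneg (G.wU_pos u).le G.total_nonneg)
  exact single_le_sum (f := fun a' => G.app (indic b) u a' ^ 2) (fun a' _ => sq_nonneg _) (mem_univ (a u))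

omit [Fintype U] [Fintype α] [DecidableEq U] [DecidableEq β] in
/-- Rewriting `∑_e w_e · lift f e (a (dst e))` vertex by vertex on Bob's side:
`= ∑_v ∑_β f(v, β) · s(v, β)` with `s(v, β)` the weight of the edges at `v` satisfied when `v ↦ β`
(given Alice's strategy `a`). [cite: DinurSteurer2014, Claim 2.3 (proof)] -/
theorem sum_wt_lift_eq (f : V → β → ℝ) (a : U → α) :
    ∑ e, G.wt e * G.lift f e (a (G.dst e)) =
      ∑ v, ∑ b, f v b * ∑ e, if G.src e = v ∧ G.proj e b = some (a (G.dst e)) then G.wt e else 0 := by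
  unfold lift
  have h1 : ∀ e, G.wt e * (∑ b, if G.proj e b = some (a (G.dst e)) then f (G.src e) b else 0) =
      ∑ v, ∑ b, f v b * (if G.src e = v ∧ G.proj e b = some (a (G.dst e)) then G.wt e else 0) := fun e => by
    rw [mul_sum]
    symm
    rw [sum_comm]
    refine sum_congr rfl fun b _ => ?_
    have : ∀ v, f v b * (if G.src e = v ∧ G.proj e b = some (a (G.dst e)) then G.wt e else 0) =
        if G.src e = v then (if G.proj e b = some (a (G.dst e)) then f v b * G.wt e else 0) else 0 := fun v => by
      split_ifs with h h' h' <;> simp_all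
    simp_rw [this]
    rw [sum_ite_eq univ (G.src e), if_pos (mem_univ _)]
    split_ifs <;> ring
  simp_rw [h1]
  rw [sum_comm]
  refine sum_congr rfl fun v _ => ?_
  rw [sum_comm]
  refine sum_congr rfl fun b _ => ?_
  rw [mul_sum]

omit [DecidableEq β] in
/-- **Dinur–Steurer, Claim 2.3, second inequality (`‖G‖² ≤ val(G)`)**: if `val(G) ≤ θ` (`0 ≤ θ`),
then every fractional assignment `f` (`f ≥ 0`, row sums `≤ 1`) has `‖G f‖² ≤ θ` — "`∑_α G f(u,α) ≤ 1`,
so `⟨G f, G f⟩ ≤ ⟨g, G f⟩` for the best proper assignment `g`; and `⟨g, G f⟩ ≤ val(G)`" (a randomized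
strategy for Bob is an average of deterministic ones; here vertex-wise maximisation).
[cite: DinurSteurer2014, Claim 2.3] -/
theorem normG_le_of_valLe [Nonempty E] {θ : ℝ} (hθ : 0 ≤ θ) (hval : G.ValLe θ) {f : V → β → ℝ}
    (hf : Nonneg f) (hf1 : ∀ v, ∑ b, f v b ≤ 1) : G.normG f ≤ θ := by
  classical
  cases isEmpty_or_nonempty α with
  | inl hα =>
    unfold normG
    simp only [univ_eq_empty, sum_empty, mul_zero, sum_const_zero]
    exact hθ
  | inr hα =>
    -- Alice's best deterministic reply `a⋆` to `G f`
    have hmax : ∀ u, ∃ a₀, ∀ a, G.app f u a ≤ G.app f u a₀ := fun u => by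
      obtain ⟨a₀, -, ha₀⟩ := exists_max_image univ (G.app f u) univ_nonempty
      exact ⟨a₀, fun a => ha₀ a (mem_univ a)⟩
    choose astar hastar using hmax
    -- `‖G f‖² ≤ 𝔼_u (G f)(u, a⋆ u)`
    have h1 : G.normG f ≤ ∑ u, G.wU u / G.total * G.app f u (astar u) := by
      unfold normG
      refine sum_le_sum fun u _ => mul_le_mul_of_nonneg_left ?_ (div_nonneg (G.wU_pos u).le G.total_nonneg)
      calc ∑ a, G.app f u a ^ 2 ≤ ∑ a, G.app f u a * G.app f u (astar u) :=
            sum_le_sum fun a _ => by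
              rw [sq]; exact mul_le_mul_of_nonneg_left (hastar u a) (G.app_nonneg hf u a)
        _ = (∑ a, G.app f u a) * G.app f u (astar u) := by rw [sum_mul]
        _ ≤ 1 * G.app f u (astar u) :=
            mul_le_mul_of_nonneg_right (G.sum_app_le_one hf hf1 u) (G.app_nonneg hf u _)
        _ = G.app f u (astar u) := one_mul _
    refine h1.trans ?_
    rw [sum_mu_app, div_le_iff₀ G.total_pos, sum_wt_lift_eq]
    -- the weights `s(v, β)` of Bob's options
    set s : V → β → ℝ := fun v b => ∑ e, if G.src e = v ∧ G.proj e b = some (astar (G.dst e)) then G.wt e else 0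
      with hs
    have hs0 : ∀ v b, 0 ≤ s v b := fun v b => sum_nonneg fun e _ => by
      split_ifs; exacts [G.wt_nonneg e, le_rfl]
    cases isEmpty_or_nonempty β with
    | inl hβ =>
      simp only [univ_eq_empty, sum_empty, sum_const_zero]
      exact mul_nonneg hθ G.total_nonneg
    | inr hβ =>
      -- Bob's best deterministic strategy `b⋆`
      have hmaxb : ∀ v, ∃ b₀, ∀ b, s v b ≤ s v b₀ := fun v => by
        obtain ⟨b₀, -, hb₀⟩ := exists_max_image univ (s v) univ_nonempty
        exact ⟨b₀, fun b => hb₀ b (mem_univ b)⟩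
      choose bstar hbstar using hmaxb
      calc ∑ v, ∑ b, f v b * s v b ≤ ∑ v, ∑ b, f v b * s v (bstar v) :=
            sum_le_sum fun v _ => sum_le_sum fun b _ => mul_le_mul_of_nonneg_left (hbstar v b) (hf v b)
        _ = ∑ v, (∑ b, f v b) * s v (bstar v) := sum_congr rfl fun v _ => by rw [sum_mul]
        _ ≤ ∑ v, 1 * s v (bstar v) :=
            sum_le_sum fun v _ => mul_le_mul_of_nonneg_right (hf1 v) (hs0 v _)
        _ = G.satW bstar astar := by
            simp only [one_mul, hs]
            unfold satW
            rw [sum_comm]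
            refine sum_congr rfl fun e _ => ?_
            have : ∀ v, (if G.src e = v ∧ G.proj e (bstar v) = some (astar (G.dst e)) then G.wt e else 0) =
                if G.src e = v then (if G.proj e (bstar v) = some (astar (G.dst e)) then G.wt e else 0) else 0 :=
              fun v => by split_ifs with h h' h' <;> simp_all
            simp_rw [this]
            rw [sum_ite_eq univ (G.src e), if_pos (mem_univ _)]
        _ ≤ θ * G.total := hval bstar astar

/-! ### Linearity of the operator -/

omit [Fintype E] [Fintype V] [Fintype U] [Fintype α] [DecidableEq V] [DecidableEq U] [DecidableEq β] in
/-- `lift` is additive. [folklore] -/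
theorem lift_add (f g : V → β → ℝ) (e : E) (a : α) : G.lift (f + g) e a = G.lift f e a + G.lift g e a := by
  unfold lift
  rw [← sum_add_distrib]
  refine sum_congr rfl fun b _ => ?_
  split_ifs <;> simp

omit [Fintype E] [Fintype V] [Fintype U] [Fintype α] [DecidableEq V] [DecidableEq U] [DecidableEq β] in
/-- `lift` is homogeneous. [folklore] -/
theorem lift_smul (c : ℝ) (f : V → β → ℝ) (e : E) (a : α) : G.lift (c • f) e a = c * G.lift f e a := by
  unfold lift
  rw [mul_sum]
  refine sum_congr rfl fun b _ => ?_
  split_ifs <;> simp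

omit [Fintype V] [Fintype U] [Fintype α] [DecidableEq V] [DecidableEq β] in
/-- `app` is additive (`G` is a linear operator). [cite: DinurSteurer2014, §2.1] -/
theorem app_add (f g : V → β → ℝ) (u : U) (a : α) : G.app (f + g) u a = G.app f u a + G.app g u a := by
  unfold app
  rw [← add_div, ← sum_add_distrib]
  congr 1
  refine sum_congr rfl fun e _ => ?_
  rw [lift_add]
  split_ifs <;> ring

omit [Fintype V] [Fintype U] [Fintype α] [DecidableEq V] [DecidableEq β] in
/-- `app` is homogeneous. [cite: DinurSteurer2014, §2.1] -/
theorem app_smul (c : ℝ) (f : V → β → ℝ) (u : U) (a : α) : G.app (c • f) u a = c * G.app f u a := by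
  unfold app
  rw [mul_div_assoc', mul_sum]
  congr 1
  refine sum_congr rfl fun e _ => ?_
  rw [lift_smul]
  split_ifs <;> ring

omit [Fintype V] [Fintype U] [Fintype α] [DecidableEq V] [DecidableEq β] in
/-- `app` of the zero function vanishes. [folklore] -/
theorem app_zero (u : U) (a : α) : G.app 0 u a = 0 := by
  unfold app lift
  simp

omit [Fintype V] [Fintype U] [Fintype α] [DecidableEq V] [DecidableEq β] in
/-- `app` commutes with finite sums of functions. [cite: DinurSteurer2014, §2.1] -/
theorem app_sum {ι : Type} (s : Finset ι) (f : ι → V → β → ℝ) (u : U) (a : α) :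
    G.app (∑ i ∈ s, f i) u a = ∑ i ∈ s, G.app (f i) u a := by
  classical
  induction s using Finset.induction_on with
  | empty => rw [sum_empty, sum_empty, app_zero]
  | insert i s hi ih => rw [sum_insert hi, sum_insert hi, app_add, ih]

end ProjGame

end Literature.Computability.Complexity
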